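import Summits.Parity.BatemanHorn.Theorems.NormalFamilyBound.Negative.NaturalBoundary

/-!
# No anchored disc about a real point `c ≥ 1` reaches `Re z ≤ 0` with a bounded family

Line-lead evidence (prover-line-stmt-Parity-9769-a1-0, 2026-08-16) for crux `NormalFamilyBound`
(stmt-Parity-9769), against transfers of the shape "local boundedness of `{H_x}` on a disc `D(c, ρ)`
anchored at a real point `c` (e.g. the Poisson anchor `c = 1`) ⇒ crux": such a disc meets the
near-zero box `{Re z ≤ 0}` only if `ρ > c`, and then it contains the real point
`y = (2 + c + ρ)/2 ∈ (2, c + ρ)`, where the family of the Bateman–Horn system `f = (X)` is unbounded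
(`fX_unbounded_of_two_lt_norm`, the natural boundary `|z| = 2`). So for `c ≥ 1` the anchored-disc
statement is FALSE for `(X)` as soon as the disc is large enough to be useful at `z = 0`
(triage TRIAGE-r1-1 finding F1, made kernel-checkable). Anchors `c < 1` are not obstructed this way.
-/

namespace Summit.Parity.BatemanHorn.Theorems.NormalFamilyBound.Negative

open Literature.NumberTheory.Sieve Polynomial Finset Filter
open Summit.Parity.BatemanHorn.Theses.SelbergDelangeRigidity

noncomputable section

/-- Geometry: a disc about a real `c ≥ 1` that contains a point with `Re w ≤ 0` has radius `ρ > c`,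
hence contains the real point `(2 + c + ρ)/2`, which has modulus `> 2`. [folklore] -/
theorem exists_real_mem_ball_two_lt {c ρ : ℝ} (hc : 1 ≤ c) {w : ℂ}
    (hw : w ∈ Metric.ball (c : ℂ) ρ) (hre : w.re ≤ 0) :
    2 < (2 + c + ρ) / 2 ∧ (((2 + c + ρ) / 2 : ℝ) : ℂ) ∈ Metric.ball (c : ℂ) ρ := by
  have hρ : c < ρ := by
    rw [Metric.mem_ball, Complex.dist_eq] at hw
    have h1 : |(w - (c : ℂ)).re| ≤ ‖w - (c : ℂ)‖ := Complex.abs_re_le_norm _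
    have h2 : (w - (c : ℂ)).re = w.re - c := by simp
    rw [h2] at h1
    have h3 : c - w.re ≤ |w.re - c| := by
      rw [abs_sub_comm]; exact le_abs_self _
    linarith
  refine ⟨by linarith, ?_⟩
  rw [Metric.mem_ball, Complex.dist_eq, ← Complex.ofReal_sub, Complex.norm_real, Real.norm_eq_abs,
    abs_lt]
  constructor <;> linarith

/-- ANCHORED DISCS, `f = (X)`: if a disc about a real anchor `c ≥ 1` contains a point with `Re w ≤ 0`
(as it must, to say anything at `z = 0` or on the near-zero box of the crux), then the family
`{H_x}` of the Bateman–Horn system `(X)` is NOT locally bounded on it (ball form, as in the crux).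
In particular "local boundedness on `D(1, ρ)`, `ρ > 1`" is false for `(X)`. [folklore] -/
theorem fX_not_locallyBoundedOn_anchoredBall {c ρ : ℝ} (hc : 1 ≤ c) {w : ℂ}
    (hw : w ∈ Metric.ball (c : ℂ) ρ) (hre : w.re ≤ 0) :
    ¬ ∀ a ∈ Metric.ball (c : ℂ) ρ, ∃ M : ℝ, ∃ r > (0 : ℝ), ∀ x : ℕ,
      ∀ z ∈ Metric.ball a r ∩ Metric.ball (c : ℂ) ρ, ‖H 1 fX x z‖ ≤ M := by
  obtain ⟨h2, hmem⟩ := exists_real_mem_ball_two_lt hc hw hre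
  refine fX_not_locallyBoundedOn (z₀ := (((2 + c + ρ) / 2 : ℝ) : ℂ)) ?_ hmem
  rw [Complex.norm_real, Real.norm_eq_abs, abs_of_pos (by linarith)]
  exact h2

/-- Uniform form: no single bound `‖H_x(z)‖ ≤ M` holds on a disc about a real anchor `c ≥ 1` that
contains a point with `Re w ≤ 0` (system `(X)`). [folklore] -/
theorem fX_not_bounded_anchoredBall {c ρ : ℝ} (hc : 1 ≤ c) {w : ℂ}
    (hw : w ∈ Metric.ball (c : ℂ) ρ) (hre : w.re ≤ 0) :
    ¬ ∃ M : ℝ, ∀ x : ℕ, ∀ z ∈ Metric.ball (c : ℂ) ρ, ‖H 1 fX x z‖ ≤ M := by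
  rintro ⟨M, hM⟩
  obtain ⟨h2, hmem⟩ := exists_real_mem_ball_two_lt hc hw hre
  have hn : 2 < ‖(((2 + c + ρ) / 2 : ℝ) : ℂ)‖ := by
    rw [Complex.norm_real, Real.norm_eq_abs, abs_of_pos (by linarith)]; exact h2
  obtain ⟨x, hx⟩ := fX_unbounded_of_two_lt_norm _ hn M
  exact absurd (hM x _ hmem) (not_le.mpr hx)

/-- The Poisson anchor `c = 1`: the disc `D(1, ρ)` contains `0` iff `ρ > 1`, and then the `(X)`-family
is not locally bounded on it — so no statement "the family is locally bounded on a disc about `1`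
containing `0`" can serve as a transfer target `C⁺ ⇒ NormalFamilyBound` (it is false for the first
Bateman–Horn system). [folklore] -/
theorem fX_not_locallyBoundedOn_ball_one {ρ : ℝ} (hρ : 1 < ρ) :
    ¬ ∀ a ∈ Metric.ball (1 : ℂ) ρ, ∃ M : ℝ, ∃ r > (0 : ℝ), ∀ x : ℕ,
      ∀ z ∈ Metric.ball a r ∩ Metric.ball (1 : ℂ) ρ, ‖H 1 fX x z‖ ≤ M := by
  have h0 : (0 : ℂ) ∈ Metric.ball ((1 : ℝ) : ℂ) ρ := by
    rw [Metric.mem_ball, Complex.dist_eq]; simpa using hρ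
  have := fX_not_locallyBoundedOn_anchoredBall (c := 1) le_rfl h0 (by simp)
  simpa using this

end

end Summit.Parity.BatemanHorn.Theorems.NormalFamilyBound.Negative
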